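import Summits.SmoothPoincare4.SmoothPoincare4.Theses.CylinderEntropy
import Summits.SmoothPoincare4.SmoothPoincare4.Theorems.CylinderEntropyRungTwoOfSurgeryResolution
import Summits.SmoothPoincare4.SmoothPoincare4.Theorems.CylinderEntropyCylinderRungTwoEpsilonRegularityOfWhite
import Literature.Geometry.Riemannian.WhiteLocalRegularityCylinderFlow
import Literature.Geometry.Riemannian.ColdingMinicozziEntropy
import HarnessLib

/-!
# Line `gap_regularity_rung` — the NO-SINGULARITY RUNG `R(λ(S⁴))` of crux `CylinderRungTwo` (stmt-SmoothPoincare4-7631)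

Forward generator G4 (ladder-down), route `route-SmoothPoincare4-CylinderEntropy`.

**The ladder.** The crux `R = CylinderRungTwo` is the member `Λ = 4/e` of the one-parameter family
`RungBelow (ofReal Λ)` := "every separating cross-section `ι : M ↪ N = S⁴ × ℝ` of a homotopy 4-sphere `M` with
cylinder entropy `λ_cyl < Λ` is standard" (`cylinderRungTwo_iff_rungBelow`, `Iff.rfl`), antitone in `Λ`.
* FLOOR (highest rung proved, tree): `Λ₀ = 1 + ε₀`, `ε₀ = 4/(1.47·e) − 1 ≈ 1.03·10⁻³`
  (`Theorems.CylinderEntropySliceIsolation.helper_sliceIsolationOfCor15b : cor15b_four → SliceIsolation`, i.e.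
  `∃ ε > 0, RungBelow (ofReal (1+ε))`, modulo the cite-only named fact Chodosh–Mantoulidis–Schulze 2023 Cor. 1.5 (b));
  its METHOD (conformal transfer `Φ : N → ℝ⁵ \ 0` + kernel domination `1.47` + CMS) is capped at
  `4/(e·λ(S⁴)) ≈ 1.0194` (tree `entropyDomination_false_of_const_lt_of_sliceCalibration`, B20; Bernstein–Wang 2016 Thm 1.1).
* THIS RUNG: `Λ₁ = λ(S⁴) = 32/(3e²) ≈ 1.4436` — the top of the regime in which the INTRINSIC mean curvature flow in `N`
  of the cross-section can form no singularity at all (every non-flat self-shrinker `Σ⁴ ⊂ ℝ⁵` arising as a blow-up has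
  Gaussian entropy `≥ λ(S⁴)`: proved for compact and partially collapsed shrinkers, Colding–Ilmanen–Minicozzi–White 2013
  Thm 0.1 / Bernstein–Wang 2016 Thm 1.1–1.2; OPEN for non-collapsed non-compact ones = the CIMW "strong conjecture", `n = 4`).
* TOP: `Λ = 4/e ≈ 1.4715` (the crux); in between sits RUNG 1 of the route header, `λ(S³×ℝ) ≈ 1.4531`.

**The line** (`rungTop_of_parts` / `CylinderRungTwo_of`, kernel-checked): W → X → N → B → `CylinderRungTwo`, where
* W `stub_regularityBelowSphereEntropy` — White's local-regularity estimate for smooth compact MCF in `N` with the density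
  threshold `1 + ε` replaced by ANY `Λ < λ(S⁴)` (= White 2005 + the Euclidean entropy gap at `λ(S⁴)`; the research stub);
* X `stub_immortalOfRegularity` — regularity below every `Λ' < Λ` ⇒ the flow of every separating section with `λ_cyl < Λ`
  is immortal and stays separating (short-time existence, continuation, Hamilton monotonicity, small-scale comparison of
  Gaussian and cylinder densities, persistence of separation; classical, SPC4-free);
* N `stub_nearSliceRecognition` — the route's support item `NearSliceRecognition` (stmt-18046; closed in the tree modulo the
  cite-only fact CMS Cor. 1.5 (b): `helper_simplyConnectedRecognition … certMid_all`);
* B `stub_bandRung` — the crux restricted to the band `λ(S⁴) ≤ λ_cyl < 4/e` (round points and necks: the surgery regime,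
  = the content of crux `CylinderSurgeryResolution`, stmt-18045) — the declared RESIDUAL of this ladder step, not its claim.
`rungSphere_of : W → X → N → RungBelow (ofReal (32/(3e²)))` is the rung itself (proved here from the stubs via the landed
immortal half `immortalLeafRecognition_of_nearSlice` and Hamilton monotonicity `IsCylinderMCF.cylEntropy_range_le_of_le`).
-/

noncomputable section

set_option linter.dupNamespace false

open MeasureTheory Set
open scoped Manifold ContDiff ENNReal NNReal Topology BigOperators ContinuousMap

namespace Summit.SmoothPoincare4.SmoothPoincare4.Cruxes.CylinderRungTwo.GapRegularityRung

open Literature.Geometry.Riemannian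
open Literature.Geometry.Lorentzian Literature.Geometry.Lorentzian.PseudoRiemannianMetric
open Literature.Geometry.Riemannian.SphericalCylinderEntropy (cylEntropy)
open Summit.SmoothPoincare4.SmoothPoincare4.Cruxes.CylinderRungTwo.KillingFlux
open Summit.SmoothPoincare4.SmoothPoincare4.Theses.CylinderEntropy

/-! ## The rung family (the crux in its own language, threshold `4/e ↦ c`) -/

/-- `RungBelow c`: every separating cross-section `ι : M ↪ N` (`M ≃ₕ S⁴`) with `λ_cyl(ι(M)) < c` is standard.
Verbatim the crux `CylinderRungTwo` with `ENNReal.ofReal (4 / Real.exp 1)` replaced by `c`. -/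
def RungBelow (c : ℝ≥0∞) : Prop :=
  ∀ (M : Type) [TopologicalSpace M] [T2Space M] [SecondCountableTopology M]
    [ChartedSpace (EuclideanSpace ℝ (Fin 4)) M] [IsManifold (𝓡 4) ∞ M],
    M ≃ₕ Metric.sphere (0 : EuclideanSpace ℝ (Fin 5)) 1 →
    ∀ ι : M → EuclideanSpace ℝ (Fin 6), Manifold.IsSmoothEmbedding (𝓡 4) (𝓡 6) ∞ ι →
    (∀ x, ∑ i : Fin 5, ι x (Fin.castSucc i) ^ 2 = 1) → SeparatesEnds (Set.range ι) →
    cylEntropy (Set.range ι) < c →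
    Nonempty (M ≃ₘ⟮𝓡 4, 𝓡 4⟯ Metric.sphere (0 : EuclideanSpace ℝ (Fin 5)) 1)

/-- The crux is the rung `c = 4/e` (definitional). -/
theorem cylinderRungTwo_iff_rungBelow :
    CylinderRungTwo ↔ RungBelow (ENNReal.ofReal (4 / Real.exp 1)) := Iff.rfl

/-- The route's support item `SliceIsolation` is `∃ ε > 0, RungBelow (1 + ε)` (definitional): the tree's FLOOR lives here. -/
theorem sliceIsolation_iff_rungBelow :
    SliceIsolation ↔ ∃ ε : ℝ, 0 < ε ∧ RungBelow (ENNReal.ofReal (1 + ε)) := Iff.rfl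

/-- Antitonicity of the ladder. -/
theorem rungBelow_anti {c c' : ℝ≥0∞} (h : c' ≤ c) (hc : RungBelow c) : RungBelow c' :=
  fun M _ _ _ _ _ e ι hι hN hsep hlt => hc M e ι hι hN hsep (lt_of_lt_of_le hlt h)

/-! ## The band (residual regime) -/

/-- `BandRung a b`: the crux restricted to separating cross-sections with `a ≤ λ_cyl < b`. -/
def BandRung (a b : ℝ≥0∞) : Prop :=
  ∀ (M : Type) [TopologicalSpace M] [T2Space M] [SecondCountableTopology M]
    [ChartedSpace (EuclideanSpace ℝ (Fin 4)) M] [IsManifold (𝓡 4) ∞ M],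
    M ≃ₕ Metric.sphere (0 : EuclideanSpace ℝ (Fin 5)) 1 →
    ∀ ι : M → EuclideanSpace ℝ (Fin 6), Manifold.IsSmoothEmbedding (𝓡 4) (𝓡 6) ∞ ι →
    (∀ x, ∑ i : Fin 5, ι x (Fin.castSucc i) ^ 2 = 1) → SeparatesEnds (Set.range ι) →
    a ≤ cylEntropy (Set.range ι) → cylEntropy (Set.range ι) < b →
    Nonempty (M ≃ₘ⟮𝓡 4, 𝓡 4⟯ Metric.sphere (0 : EuclideanSpace ℝ (Fin 5)) 1)

/-- Ladder glue: a rung plus the band above it is the next rung. -/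
theorem rungBelow_of_rungBelow_of_bandRung {a b : ℝ≥0∞} (h₁ : RungBelow a) (h₂ : BandRung a b) :
    RungBelow b := by
  intro M _ _ _ _ _ e ι hι hN hsep hlt
  rcases lt_or_ge (cylEntropy (Set.range ι)) a with h | h
  · exact h₁ M e ι hι hN hsep h
  · exact h₂ M e ι hι hN hsep h hlt

/-! ## The mechanism of the rung: immortal intrinsic flow below the first shrinker entropy -/

/-- `ImmortalBelow c`: from every separating cross-section `ι` of a homotopy 4-sphere with `λ_cyl < c` there issues an
IMMORTAL smooth mean curvature flow in `N` (`IsCylinderMCF … 0`, `F 0 = ι`) all of whose slices separate the two ends.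
(The hypothesis `(γ1)` of the landed `helper_sliceIsolationOfThinFlow`, with `1 + γ` replaced by `c`.) -/
def ImmortalBelow (c : ℝ≥0∞) : Prop :=
  ∀ (M : Type) [TopologicalSpace M] [T2Space M] [SecondCountableTopology M]
    [ChartedSpace (EuclideanSpace ℝ (Fin 4)) M] [IsManifold (𝓡 4) ∞ M],
    M ≃ₕ Metric.sphere (0 : EuclideanSpace ℝ (Fin 5)) 1 →
    ∀ ι : M → EuclideanSpace ℝ (Fin 6), Manifold.IsSmoothEmbedding (𝓡 4) (𝓡 6) ∞ ι →
    (∀ x, ∑ i : Fin 5, ι x (Fin.castSucc i) ^ 2 = 1) → SeparatesEnds (Set.range ι) →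
    cylEntropy (Set.range ι) < c →
    ∃ (F : ℝ → M → EuclideanSpace ℝ (Fin 6)) (ν : ℝ → M → EuclideanSpace ℝ (Fin 6)),
      IsCylinderMCF M F ν 0 ∧ F 0 = ι ∧ ∀ t : ℝ, 0 ≤ t → SeparatesEnds (Set.range (F t))

/-- **A smooth mean curvature flow of embedded cross-sections of `N` on the FINITE horizon `[T, T')`**: the tree's
`IsCylinderMCF` (flows on `[T, ∞)`) with every `T ≤ t` replaced by `T ≤ t < T'` — the object a continuation argument
must speak about (an `IsCylinderMCF` is immortal by type). `IsCylinderMCF.restrictOn` embeds the tree's flows. -/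
structure IsCylinderMCFOn (M : Type) [TopologicalSpace M] [ChartedSpace (EuclideanSpace ℝ (Fin 4)) M]
    [IsManifold (𝓡 4) ∞ M] (F : ℝ → M → EuclideanSpace ℝ (Fin 6)) (ν : ℝ → M → EuclideanSpace ℝ (Fin 6))
    (T T' : ℝ) : Prop where
  contMDiffOn : ∃ U : Set ℝ, IsOpen U ∧ Set.Ico T T' ⊆ U ∧
    ContMDiffOn (𝓘(ℝ, ℝ).prod (𝓡 4)) (𝓡 6) ∞ (fun p : ℝ × M => F p.1 p.2) (U ×ˢ Set.univ)
  isSmoothEmbedding : ∀ t, T ≤ t → t < T' → Manifold.IsSmoothEmbedding (𝓡 4) (𝓡 6) ∞ (F t)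
  mem_cyl : ∀ t, T ≤ t → t < T' → ∀ x, ∑ i : Fin 5, F t x (Fin.castSucc i) ^ 2 = 1
  isSpacelikeImmersion : ∀ t, T ≤ t → t < T' → (euclideanMetric (EuclideanSpace ℝ (Fin 6))).IsSpacelikeImmersion (𝓡 4) (F t)
  isUnitNormal : ∀ t, T ≤ t → t < T' → (euclideanMetric (EuclideanSpace ℝ (Fin 6))).IsUnitNormal (𝓡 4) (F t) (ν t) 1
  normal_tangent : ∀ t, T ≤ t → t < T' → ∀ x, ∑ i : Fin 5, ν t x (Fin.castSucc i) * F t x (Fin.castSucc i) = 0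
  contMDiff_normal : ∀ t, T ≤ t → t < T' → ContMDiff (𝓡 4) (𝓡 6) ∞ (ν t)
  velocity_eq : ∀ t (ht : T ≤ t) (ht' : t < T') (x : M),
    mfderiv 𝓘(ℝ, ℝ) (𝓡 6) (fun s => F s x) t (1 : ℝ) =
      -((euclideanMetric (EuclideanSpace ℝ (Fin 6))).meanCurvature (F t) contMDiff_pullbackBilin_holds
          (isSpacelikeImmersion t ht ht') (ν t) x) • ν t x

/-- The tree's immortal flows restrict to every finite horizon (interface compatibility). -/
theorem IsCylinderMCF.restrictOn {M : Type} [TopologicalSpace M] [ChartedSpace (EuclideanSpace ℝ (Fin 4)) M]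
    [IsManifold (𝓡 4) ∞ M] {F ν : ℝ → M → EuclideanSpace ℝ (Fin 6)} {T : ℝ}
    (hF : IsCylinderMCF M F ν T) (T' : ℝ) : IsCylinderMCFOn M F ν T T' where
  contMDiffOn := by
    obtain ⟨U, hU, hTU, h⟩ := hF.contMDiffOn
    exact ⟨U, hU, fun t ht => hTU ht.1, h⟩
  isSmoothEmbedding t ht _ := hF.isSmoothEmbedding t ht
  mem_cyl t ht _ := hF.mem_cyl t ht
  isSpacelikeImmersion t ht _ := hF.isSpacelikeImmersion t ht
  isUnitNormal t ht _ := hF.isUnitNormal t ht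
  normal_tangent t ht _ := hF.normal_tangent t ht
  contMDiff_normal t ht _ := hF.contMDiff_normal t ht
  velocity_eq t ht _ x := hF.velocity_eq t ht x

/-- `RegularityBelow Λ`: WHITE'S LOCAL-REGULARITY ESTIMATE WITH DENSITY THRESHOLD `Λ` for smooth compact mean curvature
flows in `N ⊂ ℝ⁶` on a finite horizon `[T, T')`: there are universal `C, c₁, d₀ > 0` such that, at any time `t` with
`T + d² ≤ t < T'` (`d ≤ d₀`), if every Euclidean Gaussian area ratio of the slices on the BACKWARD window `[t − d², t]`
at scales `r ≤ d` is `≤ Λ`, then the unit normal of `Σ_t` is chordally `(C/d)`-Lipschitz at scale `c₁ d` (a curvature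
bound `|A| ≲ C/d`). For `Λ = 1 + ε` this is White 2005 (Thm 3.1, §4 for Riemannian ambients; the tree's named fact
`White2005_localRegularity_cylinderFlowSheet` is its immortal, two-sided-window corollary). [cite: White2005, Thm. 3.1] -/
def RegularityBelow (Λ : ℝ) : Prop :=
  ∃ C : ℝ, 0 < C ∧ ∃ c₁ : ℝ, 0 < c₁ ∧ ∃ d₀ : ℝ, 0 < d₀ ∧
    ∀ (M : Type) [TopologicalSpace M] [T2Space M] [SecondCountableTopology M]
      [ChartedSpace (EuclideanSpace ℝ (Fin 4)) M] [IsManifold (𝓡 4) ∞ M] [CompactSpace M] [ConnectedSpace M]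
      (F : ℝ → M → EuclideanSpace ℝ (Fin 6)) (ν : ℝ → M → EuclideanSpace ℝ (Fin 6)) (T T' : ℝ),
      IsCylinderMCFOn M F ν T T' →
      ∀ t d : ℝ, 0 < d → d ≤ d₀ → T + d ^ 2 ≤ t → t < T' →
        (∀ (y : EuclideanSpace ℝ (Fin 6)) (s r : ℝ), 0 < r → t - d ^ 2 ≤ s - r ^ 2 → s ≤ t →
          gaussianArea 4 y (r ^ 2) (Set.range (F (s - r ^ 2))) ≤ ENNReal.ofReal Λ) →
        ∀ x y : M, ‖F t x - F t y‖ ≤ c₁ * d → ‖ν t x - ν t y‖ ≤ C / d * ‖F t x - F t y‖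

/-! ## Registered stubs -/

/-- **Stub W (research; the Euclidean gap, typed as regularity).** White's estimate holds with threshold any
`Λ < λ(S⁴) = 32/(3e²)`: a blow-up limit of smooth compact flows in `N` with Gaussian density `< λ(S⁴)` at a point has a
non-flat self-shrinking tangent flow in `ℝ⁵ (= T N)` of entropy `< λ(S⁴)` — excluded for compact (CIMW 2013 Thm 0.1,
Bernstein–Wang 2016 Thm 1.1) and partially collapsed (Bernstein–Wang 2016 Thm 1.2) shrinkers; the non-collapsed
non-compact case (asymptotically conical shrinkers, stationary cones over minimal `Σ³ ⊂ S⁴`) is the OPEN input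
(CIMW strong conjecture, `n = 4`; Chodosh–Mantoulidis–Schulze 2023 Cor. 1.5 is "new when n ∈ {4,5}" for exactly this reason).
[cite: White2005, Thm. 3.1, §4] [cite: BernsteinWang2016, Thm. 1.1–1.2] -/
theorem stub_regularityBelowSphereEntropy :
    ∀ Λ : ℝ, Λ < 32 / (3 * Real.exp 2) → RegularityBelow Λ := by
  sorry

/-- **Stub X (classical parabolic PDE in `N`, SPC4-free).** If White-type regularity holds below every `Λ' < Λ`, then the
mean curvature flow in `N` of any separating cross-section with `λ_cyl < Λ` exists for all time, stays embedded and keeps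
separating the ends: short-time existence and continuation for the quasilinear system, Hamilton's monotonicity
(`λ_cyl` non-increasing: `IsCylinderMCF.cylEntropy_range_le_of_le`), the small-scale comparison "Gaussian area ratio
`≤ (1 + o(1)) ·` cylinder density" feeding the hypothesis of `RegularityBelow Λ'` with `λ_cyl < Λ' < Λ`, whence a uniform
curvature bound past every finite time, and persistence of separation along the isotopy. [folklore]
[cite: Hamilton1993, Thm. 4.1] [cite: White2005, Thm. 3.5] -/
theorem stub_immortalOfRegularity :
    ∀ Λ : ℝ, (∀ Λ' : ℝ, Λ' < Λ → RegularityBelow Λ') → ImmortalBelow (ENNReal.ofReal Λ) := by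
  sorry

/-- **Stub N (floor recognition = route item `NearSliceRecognition`, stmt-SmoothPoincare4-18046).** Closed in the tree
modulo the cite-only fact CMS Cor. 1.5 (b): `helper_simplyConnectedRecognition hb certMid_all`.
[cite: ChodoshMantoulidisSchulze2023b, Cor. 1.5 (b)] -/
theorem stub_nearSliceRecognition : NearSliceRecognition := by
  sorry

/-- **Stub B (RESIDUAL band, not this step's claim).** The crux on the band `λ(S⁴) ≤ λ_cyl < 4/e`: the regime of round
points and neck singularities, i.e. the surgery content carried by crux `CylinderSurgeryResolution` (stmt-18045) and the
registered line `killing_flux`. [cite: ChodoshMantoulidisSchulze2023b, Thm. 1.13] [cite: DanielsHolgate2022, Thm. 1.3] -/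
theorem stub_bandRung :
    BandRung (ENNReal.ofReal (32 / (3 * Real.exp 2))) (ENNReal.ofReal (4 / Real.exp 1)) := by
  sorry

/-! ## Proved: the rung from the stubs, and the composition concluding the crux -/

/-- Numerics: `λ(S⁴) = 32/(3e²) ≤ 2`. -/
theorem ofReal_lamSphere_le_two : ENNReal.ofReal (32 / (3 * Real.exp 2)) ≤ 2 := by
  have h2 : (2 : ℝ≥0∞) = ENNReal.ofReal 2 := by simp
  rw [h2]
  refine ENNReal.ofReal_le_ofReal ?_
  have he : (2.7182818283 : ℝ) < Real.exp 1 := Real.exp_one_gt_d9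
  have hexp2 : Real.exp 2 = Real.exp 1 * Real.exp 1 := by rw [← Real.exp_add]; norm_num
  rw [div_le_iff₀ (by positivity), hexp2]
  nlinarith [Real.exp_pos 1]

/-- Numerics: `λ(S⁴) = 32/(3e²) ≤ 4/e` (the rung lies below the crux). -/
theorem lamSphere_le_fourOverE : 32 / (3 * Real.exp 2) ≤ 4 / Real.exp 1 := by
  have he : (2.7182818283 : ℝ) < Real.exp 1 := Real.exp_one_gt_d9
  have hexp2 : Real.exp 2 = Real.exp 1 * Real.exp 1 := by rw [← Real.exp_add]; norm_num
  rw [div_le_div_iff₀ (by positivity) (Real.exp_pos 1), hexp2]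
  nlinarith [Real.exp_pos 1]

/-- **Immortality ⇒ rung** (the glue of the mechanism, proved): below `c ≤ 2`, an immortal separating flow from `ι` has
`λ_cyl < 2` for all `t ≥ 0` by Hamilton monotonicity, so the landed immortal half `immortalLeafRecognition_of_nearSlice`
(tilt decay → small-tilt graphicality → area floor → floor recognition) gives `M ≅ S⁴`; the instances `CompactSpace`,
`PathConnectedSpace`, `SimplyConnectedSpace` come from `M ≃ₕ S⁴`. -/
theorem rungBelow_of_immortalBelow (hN : NearSliceRecognition) {c : ℝ≥0∞} (hc : c ≤ 2)
    (hI : ImmortalBelow c) : RungBelow c := by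
  intro M _ _ _ _ _ e ι hι hIn hsep hent
  haveI : CompactSpace M :=
    Literature.Topology.FourManifolds.compactSpace_of_homotopyEquiv_sphere_four_holds M e
  haveI : PathConnectedSpace M := by
    haveI := Literature.Topology.FourManifolds.pathConnectedSpace_sphere_four
    exact Literature.Topology.FourManifolds.pathConnectedSpace_of_homotopyEquiv e
  have hsc : SimplyConnectedSpace M :=
    Literature.Topology.FourManifolds.simplyConnectedSpace_of_homotopyEquiv_sphere_four
      Literature.Topology.FourManifolds.simplyConnectedSpace_sphere_four_holds M e
  obtain ⟨F, ν, hF, hF0, hsepF⟩ := hI M e ι hι hIn hsep hent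
  refine immortalLeafRecognition_of_nearSlice hN M hsc F ν 0 hF hsepF ?_
  intro t ht
  calc cylEntropy (Set.range (F t)) ≤ cylEntropy (Set.range (F 0)) :=
        hF.cylEntropy_range_le_of_le le_rfl ht
    _ = cylEntropy (Set.range ι) := by rw [hF0]
    _ < 2 := lt_of_lt_of_le hent hc

/-- **THE RUNG `R(λ(S⁴))`** from stubs W, X, N. -/
theorem rungSphere_of
    (hW : ∀ Λ : ℝ, Λ < 32 / (3 * Real.exp 2) → RegularityBelow Λ)
    (hX : ∀ Λ : ℝ, (∀ Λ' : ℝ, Λ' < Λ → RegularityBelow Λ') → ImmortalBelow (ENNReal.ofReal Λ))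
    (hN : NearSliceRecognition) :
    RungBelow (ENNReal.ofReal (32 / (3 * Real.exp 2))) :=
  rungBelow_of_immortalBelow hN ofReal_lamSphere_le_two (hX _ hW)

/-- Hypothesis-style composition: the four stub STATEMENTS imply the top rung `RungBelow (4/e)` (= the crux, `Iff.rfl`). -/
theorem rungTop_of_parts
    (hW : ∀ Λ : ℝ, Λ < 32 / (3 * Real.exp 2) → RegularityBelow Λ)
    (hX : ∀ Λ : ℝ, (∀ Λ' : ℝ, Λ' < Λ → RegularityBelow Λ') → ImmortalBelow (ENNReal.ofReal Λ))
    (hN : NearSliceRecognition)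
    (hB : BandRung (ENNReal.ofReal (32 / (3 * Real.exp 2))) (ENNReal.ofReal (4 / Real.exp 1))) :
    RungBelow (ENNReal.ofReal (4 / Real.exp 1)) :=
  rungBelow_of_rungBelow_of_bandRung (rungSphere_of hW hX hN) hB

/-- **Composition** (kernel-checked; `sorry` only inside the four registered stubs): the crux BY NAME from
`stub_regularityBelowSphereEntropy`, `stub_immortalOfRegularity`, `stub_nearSliceRecognition`, `stub_bandRung`. -/
theorem CylinderRungTwo_of : Summit.SmoothPoincare4.SmoothPoincare4.Theses.CylinderEntropy.CylinderRungTwo :=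
  cylinderRungTwo_iff_rungBelow.2
    (rungTop_of_parts stub_regularityBelowSphereEntropy stub_immortalOfRegularity stub_nearSliceRecognition
      stub_bandRung)

/-- The rung itself from the registered stubs W, X, N (no band stub). -/
theorem rungSphere : RungBelow (ENNReal.ofReal (32 / (3 * Real.exp 2))) :=
  rungSphere_of stub_regularityBelowSphereEntropy stub_immortalOfRegularity stub_nearSliceRecognition

end Summit.SmoothPoincare4.SmoothPoincare4.Cruxes.CylinderRungTwo.GapRegularityRung

end
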